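import Summits.BirchSwinnertonDyer.BirchSwinnertonDyer.Theorems.ErratumRoadFiveRest3TRLeverRungsSplitD
import Summits.BirchSwinnertonDyer.BirchSwinnertonDyer.Theses.ErratumRoadFive
import HarnessLib

/-!
# Route `ErratumRoadFive` (rung K2, `p ≥ 5`), crux `RamNoErratumDataAtFive` (item stmt-BirchSwinnertonDyer-19624, REST‴):
# the registered lever rungs R21 `stub_rung_shaDiv_TR7_lever`, R22 `stub_rung_shaDiv_TR8_lever` (skeleton v14) at the last two TR members BY NAME,
# and `BSD(TRᵢ, 5)` on the lever from the items
# (cell `bsd-stepL`, OWNER seat `bsd-stepL-rest-p2` g8; `--supports stmt-BirchSwinnertonDyer-19624`; leaf)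

HONEST FRAMING: THEOREMS ONLY; CONDITIONAL on the route's published support items; two curves; nothing booked; Schneider's conjecture class-wide
asserted NOWHERE. Twin of `Theorems/ErratumRoadFiveRest3TRLeverRungsByName.lean` (TR1, TR2) for TR7, TR8; the regulator certificates are seat
tam3-p2's `RegMult.HeightLogNumerator.certSplit_TR7 ∕ _TR8` (regime-free split row checker p596892, rows `…ExactPRowsTRCert`), consumed through
`Theorems/ErratumRoadFiveRest3TRLeverRungsSplitD.lean` (this seat).
References: [Skinner2016PacificMC] Thm. A; [SteinWuthrich2013] Thm. 6.1, §4.2, Conj. 4.1; [Disegni2020] Thm. 1, (∗); [JetchevSkinnerWan2017] Thm. 3.3.1;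
[KolyvaginEulerSystems1990] Thm. A.
-/

-- the Theorems namespace of this sub repeats the summit name by design (D-0017 nested layout)
set_option linter.dupNamespace false

noncomputable section

open scoped Classical

open WeierstrassCurve
  Literature.NumberTheory.EllipticCurves Literature.NumberTheory.EllipticCurves.ModularForms
  Literature.NumberTheory.EllipticCurves.Rank1Residual
  Literature.NumberTheory.EllipticCurves.Rank1Residual.Typed
  Literature.NumberTheory.EllipticCurves.JetchevSkinnerWan2017
  Literature.NumberTheory.EllipticCurves.SteinWuthrich2013
  Literature.NumberTheory.EllipticCurves.Disegni2020
  Literature.NumberTheory.EllipticCurves.Skinner2016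
  Summit.BirchSwinnertonDyer.Rank1Residual Summit.BirchSwinnertonDyer.Rank1Residual.X11b
  Summit.BirchSwinnertonDyer.BirchSwinnertonDyer.Theses.ErratumRoadFive

namespace Summit.BirchSwinnertonDyer.BirchSwinnertonDyer.Theorems

namespace Rest3Rungs

/-- **REGISTERED RUNG `stub_rung_shaDiv_TR7_lever` (skeleton v14) BY NAME — LEVER-ROAD RUNG at `(TR7, 5)`, a SPLIT member of TR = SD ∩ REST⁗**
(TR7 = 1770b1 ⊗ 2557; certificate `Q = 10·g, level 2, v₅(ĥ^{split}) = 1`): `PublishedInputsFive` (19066) + `JSWAnticyclotomicControlMult` (19626) + the lever-fact bundle ⟹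
`P2OpenInputOnTreeAt TR7 5` — NO certificate or data binder. CONDITIONAL on the published items; ONE curve; nothing booked.
[cite: Skinner2016PacificMC, Thm. A (§1)] [cite: SteinWuthrich2013, Thm. 6.1, §4.2] [cite: Disegni2020, Thm. 1 (§1.2), (∗)] [cite: JetchevSkinnerWan2017, Thm. 3.3.1] -/
theorem stub_rung_shaDiv_TR7_lever
    [((⟨1, 0, 0, 107744895, 14656843485⟩ : WeierstrassCurve ℤ).baseChange ℚ).IsElliptic]
    [((⟨1, 0, 0, 107744895, 14656843485⟩ : WeierstrassCurve ℤ).baseChange ℚ).IsGloballyMinimal]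
    (hF : Summit.BirchSwinnertonDyer.BirchSwinnertonDyer.Theses.ErratumRoadFive.PublishedInputsFive)
    (h331 : Summit.BirchSwinnertonDyer.BirchSwinnertonDyer.Theses.ErratumRoadFive.JSWAnticyclotomicControlMult)
    (hL : Literature.NumberTheory.EllipticCurves.Skinner2016.thmA_charIdeal_multiplicative ∧
      Literature.NumberTheory.EllipticCurves.SteinWuthrich2013.thm61_nonsplitMultiplicative ∧
      Literature.NumberTheory.EllipticCurves.SteinWuthrich2013.thm61_splitMultiplicative ∧
      Literature.NumberTheory.EllipticCurves.SteinWuthrich2013.exists_isMultCanonical ∧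
      Literature.NumberTheory.EllipticCurves.SteinWuthrich2013.exists_isSplitMultCanonical ∧
      Literature.NumberTheory.EllipticCurves.Disegni2020.thm1_padicBSD_rankOne_multiplicative ∧
      Literature.NumberTheory.EllipticCurves.ModularForms.nonempty_modularParametrizationData) :
    Summit.BirchSwinnertonDyer.Rank1Residual.X11b.P2OpenInputOnTreeAt
      ((⟨1, 0, 0, 107744895, 14656843485⟩ : WeierstrassCurve ℤ).baseChange ℚ) 5 := by
  obtain ⟨hGZ, hKo, -, hSk, -, hGZK, hmod, -, -, -, -, -, -, -, -⟩ := hF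
  obtain ⟨hSkA, -, hJs, -, hHs, hD, hpar⟩ := hL
  exact rung_TR7_lever hGZ hKo hSk hGZK hmod h331 hSkA hJs hHs hD hpar

/-- **`BSD(TR7, 5)` on the lever from the support item `PublishedInputsFive` (GZK) + the lever-fact bundle**, given `ClassX11b TR7 5` — the split-half
Schneider input being tam3-p2's kernel certificate. ONE curve; nothing class-wide. [cite: SteinWuthrich2013, §4.2 and Conj. 4.1] [cite: Disegni2020, Thm. 1, (∗)]
[cite: KolyvaginEulerSystems1990, Thm. A] -/
theorem bsdpOnTR_TR7_of_items
    [((⟨1, 0, 0, 107744895, 14656843485⟩ : WeierstrassCurve ℤ).baseChange ℚ).IsElliptic] [((⟨1, 0, 0, 107744895, 14656843485⟩ : WeierstrassCurve ℤ).baseChange ℚ).IsGloballyMinimal]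
    (hF : PublishedInputsFive)
    (hL : Literature.NumberTheory.EllipticCurves.Skinner2016.thmA_charIdeal_multiplicative ∧
      Literature.NumberTheory.EllipticCurves.SteinWuthrich2013.thm61_nonsplitMultiplicative ∧
      Literature.NumberTheory.EllipticCurves.SteinWuthrich2013.thm61_splitMultiplicative ∧
      Literature.NumberTheory.EllipticCurves.SteinWuthrich2013.exists_isMultCanonical ∧
      Literature.NumberTheory.EllipticCurves.SteinWuthrich2013.exists_isSplitMultCanonical ∧
      Literature.NumberTheory.EllipticCurves.Disegni2020.thm1_padicBSD_rankOne_multiplicative ∧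
      Literature.NumberTheory.EllipticCurves.ModularForms.nonempty_modularParametrizationData)
    (hX : ClassX11b ((⟨1, 0, 0, 107744895, 14656843485⟩ : WeierstrassCurve ℤ).baseChange ℚ) 5) :
    BSDp ((⟨1, 0, 0, 107744895, 14656843485⟩ : WeierstrassCurve ℤ).baseChange ℚ) 5 := by
  obtain ⟨-, -, -, -, -, hGZK, -, -, -, -, -, -, -, -, -⟩ := hF
  obtain ⟨hSkA, -, hJs, -, hHs, hD, hpar⟩ := hL
  exact bsdp_TR7_lever hSkA hJs hHs hD hpar hGZK hX

/-- **REGISTERED RUNG `stub_rung_shaDiv_TR8_lever` (skeleton v14) BY NAME — LEVER-ROAD RUNG at `(TR8, 5)`, a SPLIT member of TR = SD ∩ REST⁗**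
(TR8 = 3510j1 ⊗ 857; certificate `Q = 40·g, level 3, v₅(ĥ^{split}) = 2`): `PublishedInputsFive` (19066) + `JSWAnticyclotomicControlMult` (19626) + the lever-fact bundle ⟹
`P2OpenInputOnTreeAt TR8 5` — NO certificate or data binder. CONDITIONAL on the published items; ONE curve; nothing booked.
[cite: Skinner2016PacificMC, Thm. A (§1)] [cite: SteinWuthrich2013, Thm. 6.1, §4.2] [cite: Disegni2020, Thm. 1 (§1.2), (∗)] [cite: JetchevSkinnerWan2017, Thm. 3.3.1] -/
theorem stub_rung_shaDiv_TR8_lever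
    [((⟨1, -1, 0, -1476380199, -21149829976195⟩ : WeierstrassCurve ℤ).baseChange ℚ).IsElliptic]
    [((⟨1, -1, 0, -1476380199, -21149829976195⟩ : WeierstrassCurve ℤ).baseChange ℚ).IsGloballyMinimal]
    (hF : Summit.BirchSwinnertonDyer.BirchSwinnertonDyer.Theses.ErratumRoadFive.PublishedInputsFive)
    (h331 : Summit.BirchSwinnertonDyer.BirchSwinnertonDyer.Theses.ErratumRoadFive.JSWAnticyclotomicControlMult)
    (hL : Literature.NumberTheory.EllipticCurves.Skinner2016.thmA_charIdeal_multiplicative ∧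
      Literature.NumberTheory.EllipticCurves.SteinWuthrich2013.thm61_nonsplitMultiplicative ∧
      Literature.NumberTheory.EllipticCurves.SteinWuthrich2013.thm61_splitMultiplicative ∧
      Literature.NumberTheory.EllipticCurves.SteinWuthrich2013.exists_isMultCanonical ∧
      Literature.NumberTheory.EllipticCurves.SteinWuthrich2013.exists_isSplitMultCanonical ∧
      Literature.NumberTheory.EllipticCurves.Disegni2020.thm1_padicBSD_rankOne_multiplicative ∧
      Literature.NumberTheory.EllipticCurves.ModularForms.nonempty_modularParametrizationData) :
    Summit.BirchSwinnertonDyer.Rank1Residual.X11b.P2OpenInputOnTreeAt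
      ((⟨1, -1, 0, -1476380199, -21149829976195⟩ : WeierstrassCurve ℤ).baseChange ℚ) 5 := by
  obtain ⟨hGZ, hKo, -, hSk, -, hGZK, hmod, -, -, -, -, -, -, -, -⟩ := hF
  obtain ⟨hSkA, -, hJs, -, hHs, hD, hpar⟩ := hL
  exact rung_TR8_lever hGZ hKo hSk hGZK hmod h331 hSkA hJs hHs hD hpar

/-- **`BSD(TR8, 5)` on the lever from the support item `PublishedInputsFive` (GZK) + the lever-fact bundle**, given `ClassX11b TR8 5` — the split-half
Schneider input being tam3-p2's kernel certificate. ONE curve; nothing class-wide. [cite: SteinWuthrich2013, §4.2 and Conj. 4.1] [cite: Disegni2020, Thm. 1, (∗)]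
[cite: KolyvaginEulerSystems1990, Thm. A] -/
theorem bsdpOnTR_TR8_of_items
    [((⟨1, -1, 0, -1476380199, -21149829976195⟩ : WeierstrassCurve ℤ).baseChange ℚ).IsElliptic] [((⟨1, -1, 0, -1476380199, -21149829976195⟩ : WeierstrassCurve ℤ).baseChange ℚ).IsGloballyMinimal]
    (hF : PublishedInputsFive)
    (hL : Literature.NumberTheory.EllipticCurves.Skinner2016.thmA_charIdeal_multiplicative ∧
      Literature.NumberTheory.EllipticCurves.SteinWuthrich2013.thm61_nonsplitMultiplicative ∧
      Literature.NumberTheory.EllipticCurves.SteinWuthrich2013.thm61_splitMultiplicative ∧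
      Literature.NumberTheory.EllipticCurves.SteinWuthrich2013.exists_isMultCanonical ∧
      Literature.NumberTheory.EllipticCurves.SteinWuthrich2013.exists_isSplitMultCanonical ∧
      Literature.NumberTheory.EllipticCurves.Disegni2020.thm1_padicBSD_rankOne_multiplicative ∧
      Literature.NumberTheory.EllipticCurves.ModularForms.nonempty_modularParametrizationData)
    (hX : ClassX11b ((⟨1, -1, 0, -1476380199, -21149829976195⟩ : WeierstrassCurve ℤ).baseChange ℚ) 5) :
    BSDp ((⟨1, -1, 0, -1476380199, -21149829976195⟩ : WeierstrassCurve ℤ).baseChange ℚ) 5 := by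
  obtain ⟨-, -, -, -, -, hGZK, -, -, -, -, -, -, -, -, -⟩ := hF
  obtain ⟨hSkA, -, hJs, -, hHs, hD, hpar⟩ := hL
  exact bsdp_TR8_lever hSkA hJs hHs hD hpar hGZK hX

end Rest3Rungs

end Summit.BirchSwinnertonDyer.BirchSwinnertonDyer.Theorems

end
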